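import Mathlib
import Literature.Geometry.Symplectic.JHolomorphicKthRootNormalForm
import Literature.Geometry.Symplectic.JAdaptedNormalFrameChart
import HarnessLib

/-!
# The `(zᵏ, û)` normal form in a chart adapted to `J` along the tangent axis (Wendl 2020, §B.2.3)

Let `F` be a real normed space of dimension `4`, `J` a smooth almost complex structure on an open
`U ⊆ F`, and `u : B(z₀,R) → U` a smooth `J`-holomorphic curve, not locally constant at `z₀`.
`Literature.Geometry.Symplectic.jHolomorphic_kthRootNormalForm` writes `Θ(u z) = (ξ(z)ᵏ, û(ξ z))`
for an AFFINE chart `Θ`. Here (`jHolomorphic_adaptedNormalForm`) the same normal form is re-run in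
the NONLINEAR chart of Wendl 2020, §B.2.3, conditions (1)–(3) (in the weak form of condition (3)
provided by `Literature.Geometry.Symplectic.NormalFrameChart.exists_normalFrameChart`): the
transported almost complex structure `J̃ = Θ_* J` is smooth near `0`, squares to `-1`, and is
STANDARD ON NORMAL VECTORS ALONG THE TANGENT AXIS, `J̃(q,0)(0,w) = (0, iw)` — exactly what
Lemma B.32 (`Literature.Geometry.Symplectic.NormalPushoff.exists_frame_estimates`) and the branch
equations (B.20) (`Literature.Geometry.Symplectic.RotationBranch.exists_regular_branch`) consume.
With it we export the quantitative form of Lemma B.29 (`|û(w)| ≤ C|w|^{k+1}`, `‖dû(w)‖ ≤ C|w|ᵏ`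
on a ball), the `J̃`-holomorphicity of the chart curve `Θ ∘ u`, and bounds for the inverse `C¹`
chart `ξ⁻¹` on that ball.

Construction: linear coordinates `Φ` with `Φ J(u z₀) = iΦ` and holomorphic leading term
`Φ(u(z₀+z) - u z₀) = zᵏ b + O(|z|^{k+1})` (`jHolomorphic_leadingTerm`); a complex-linear `A` with
`A b = (1,0)` (`exists_equiv_prod_apply_eq`), so that the affine chart `Θ₁ = A Φ (· - u z₀)`
carries `J` to a smooth `J̃₁` with `J̃₁(0) = i` and the tangent line to `ℂ × {0}`; the normal-frame
chart `Θc` of `J̃₁` (`exists_normalFrameChart`, `DΘc(0) = 𝟙`); the leading term of `u` in the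
composite chart `A⁻¹ ∘ Θc ∘ Θ₁` (`jHolomorphic_leadingTerm_chart`) is again `(k, b)` by
UNIQUENESS OF LEADING TERMS (`leadingTerm_unique`; `Θc = 𝟙 + O(|y|²)`,
`exists_norm_sub_self_le_sq`), and `normalForm_of_chart` finishes.

Everything is proved; no named facts.

## References

* C. Wendl, *Lectures on Contact 3-Manifolds, Holomorphic Curves and Intersection Theory*,
  Cambridge Tracts in Math. 220 (2020), App. B, Thm B.23, §B.2.3 (conditions (1)–(3), (B.15),
  Lemma B.29), Lemma B.32. [Wendl2020]
* M. Micallef, B. White, *The structure of branch points in minimal surfaces and in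
  pseudoholomorphic curves*, Ann. of Math. 141 (1995), Thm 6.1. [MicallefWhite1995]
* D. McDuff, D. Salamon, *J-holomorphic curves and symplectic topology*, 2nd ed. (2012), §2.3,
  App. E. [McDuffSalamon2012]
-/

noncomputable section

open scoped ContDiff Topology
open Set Filter Metric Function Complex Asymptotics

namespace Literature.Geometry.Symplectic

open Literature.Analysis.Complex Literature.Analysis.Complex.KthRootChart

/-! ### Uniqueness of holomorphic leading terms -/

/-- If `f(z) = zᵏ b + O(|z|^{k+1}) = z^{k'} b' + O(|z|^{k'+1})` near `0` with `b ≠ 0`, then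
`k' ≤ k`. [folklore] -/
theorem leadingTerm_order_le {G : Type*} [NormedAddCommGroup G] [NormedSpace ℂ G] {f : ℂ → G}
    {k k' : ℕ} {b b' : G} {C C' ρ : ℝ} (hρ : 0 < ρ) (hb : b ≠ 0)
    (h : ∀ z ∈ ball (0 : ℂ) ρ, ‖f z - z ^ k • b‖ ≤ C * ‖z‖ ^ (k + 1))
    (h' : ∀ z ∈ ball (0 : ℂ) ρ, ‖f z - z ^ k' • b'‖ ≤ C' * ‖z‖ ^ (k' + 1)) : k' ≤ k := by
  by_contra hlt
  push Not at hlt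
  set K : ℝ := |C| + |C'| + ‖b'‖ with hK
  have hev : ∀ᶠ t in 𝓝[>] (0 : ℝ), ‖b‖ ≤ K * t := by
    filter_upwards [Ioo_mem_nhdsGT (lt_min hρ one_pos)] with t ht
    obtain ⟨ht0, ht1⟩ := ht
    have htρ : t < ρ := ht1.trans_le (min_le_left _ _)
    have ht1' : t ≤ 1 := (ht1.trans_le (min_le_right _ _)).le
    set z : ℂ := (t : ℂ) with hz_def
    have hz : ‖z‖ = t := by rw [hz_def, Complex.norm_real, Real.norm_of_nonneg ht0.le]
    have hzb : z ∈ ball (0 : ℂ) ρ := by rw [mem_ball, dist_zero_right, hz]; exact htρ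
    have e1 := h z hzb
    have e2 := h' z hzb
    rw [hz] at e1 e2
    have n1 : ‖z ^ k • b‖ = t ^ k * ‖b‖ := by rw [norm_smul, norm_pow, hz]
    have n2 : ‖z ^ k' • b'‖ = t ^ k' * ‖b'‖ := by rw [norm_smul, norm_pow, hz]
    have tri : ‖z ^ k • b‖ ≤ ‖f z - z ^ k • b‖ + ‖f z - z ^ k' • b'‖ + ‖z ^ k' • b'‖ := by
      have hid : z ^ k • b = -(f z - z ^ k • b) + (f z - z ^ k' • b') + z ^ k' • b' := by abel
      calc ‖z ^ k • b‖ = ‖-(f z - z ^ k • b) + (f z - z ^ k' • b') + z ^ k' • b'‖ := by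
            rw [← hid]
        _ ≤ ‖-(f z - z ^ k • b)‖ + ‖f z - z ^ k' • b'‖ + ‖z ^ k' • b'‖ := norm_add₃_le
        _ = _ := by rw [norm_neg]
    have p1 : t ^ (k' + 1) ≤ t ^ (k + 1) := pow_le_pow_of_le_one ht0.le ht1' (by omega)
    have p2 : t ^ k' ≤ t ^ (k + 1) := pow_le_pow_of_le_one ht0.le ht1' (by omega)
    have htk : 0 < t ^ k := pow_pos ht0 k
    have hb1 : t ^ k * ‖b‖ ≤ (K * t) * t ^ k := by
      rw [← n1]
      calc ‖z ^ k • b‖ ≤ ‖f z - z ^ k • b‖ + ‖f z - z ^ k' • b'‖ + ‖z ^ k' • b'‖ := tri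
        _ ≤ C * t ^ (k + 1) + C' * t ^ (k' + 1) + t ^ k' * ‖b'‖ := by rw [n2]; gcongr
        _ ≤ |C| * t ^ (k + 1) + |C'| * t ^ (k' + 1) + t ^ k' * ‖b'‖ := by
            gcongr
            · exact le_abs_self C
            · exact le_abs_self C'
        _ ≤ |C| * t ^ (k + 1) + |C'| * t ^ (k + 1) + t ^ (k + 1) * ‖b'‖ := by gcongr
        _ = (K * t) * t ^ k := by rw [hK]; ring
    rw [mul_comm] at hb1
    exact le_of_mul_le_mul_right hb1 htk
  have hlim : Tendsto (fun t : ℝ => K * t) (𝓝[>] (0 : ℝ)) (𝓝 0) := by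
    have : Tendsto (fun t : ℝ => K * t) (𝓝 0) (𝓝 (K * 0)) := tendsto_const_nhds.mul tendsto_id
    rw [mul_zero] at this
    exact this.mono_left nhdsWithin_le_nhds
  have hle : ‖b‖ ≤ 0 := ge_of_tendsto hlim hev
  exact hb (norm_le_zero_iff.1 hle)

/-- **Uniqueness of holomorphic leading terms**: if `f(z) = zᵏ b + O(|z|^{k+1})` and
`f(z) = z^{k'} b' + O(|z|^{k'+1})` near `0` with `b, b' ≠ 0`, then `k = k'` and `b = b'`.
[cite: Wendl2020, App. B, Thm B.23 ("there exists a unique integer `k`") and Cor. B.21] -/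
theorem leadingTerm_unique {G : Type*} [NormedAddCommGroup G] [NormedSpace ℂ G] {f : ℂ → G}
    {k k' : ℕ} {b b' : G} {C C' ρ : ℝ} (hρ : 0 < ρ) (hb : b ≠ 0) (hb' : b' ≠ 0)
    (h : ∀ z ∈ ball (0 : ℂ) ρ, ‖f z - z ^ k • b‖ ≤ C * ‖z‖ ^ (k + 1))
    (h' : ∀ z ∈ ball (0 : ℂ) ρ, ‖f z - z ^ k' • b'‖ ≤ C' * ‖z‖ ^ (k' + 1)) :
    k = k' ∧ b = b' := by
  have h1 : k' ≤ k := leadingTerm_order_le hρ hb h h'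
  have h2 : k ≤ k' := leadingTerm_order_le hρ hb' h' h
  have hkk : k = k' := le_antisymm h2 h1
  subst hkk
  refine ⟨rfl, ?_⟩
  set K : ℝ := |C| + |C'| with hK
  have hev : ∀ᶠ t in 𝓝[>] (0 : ℝ), ‖b - b'‖ ≤ K * t := by
    filter_upwards [Ioo_mem_nhdsGT hρ] with t ht
    obtain ⟨ht0, htρ⟩ := ht
    set z : ℂ := (t : ℂ) with hz_def
    have hz : ‖z‖ = t := by rw [hz_def, Complex.norm_real, Real.norm_of_nonneg ht0.le]
    have hzb : z ∈ ball (0 : ℂ) ρ := by rw [mem_ball, dist_zero_right, hz]; exact htρ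
    have e1 := h z hzb
    have e2 := h' z hzb
    rw [hz] at e1 e2
    have htk : 0 < t ^ k := pow_pos ht0 k
    have hid : z ^ k • (b - b') = (f z - z ^ k • b') - (f z - z ^ k • b) := by
      rw [smul_sub]; abel
    have hb1 : t ^ k * ‖b - b'‖ ≤ (K * t) * t ^ k := by
      calc t ^ k * ‖b - b'‖ = ‖z ^ k • (b - b')‖ := by rw [norm_smul, norm_pow, hz]
        _ = ‖(f z - z ^ k • b') - (f z - z ^ k • b)‖ := by rw [hid]
        _ ≤ ‖f z - z ^ k • b'‖ + ‖f z - z ^ k • b‖ := norm_sub_le _ _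
        _ ≤ C' * t ^ (k + 1) + C * t ^ (k + 1) := add_le_add e2 e1
        _ ≤ |C'| * t ^ (k + 1) + |C| * t ^ (k + 1) := by
            gcongr
            · exact le_abs_self C'
            · exact le_abs_self C
        _ = (K * t) * t ^ k := by rw [hK]; ring
    rw [mul_comm] at hb1
    exact le_of_mul_le_mul_right hb1 htk
  have hlim : Tendsto (fun t : ℝ => K * t) (𝓝[>] (0 : ℝ)) (𝓝 0) := by
    have : Tendsto (fun t : ℝ => K * t) (𝓝 0) (𝓝 (K * 0)) := tendsto_const_nhds.mul tendsto_id
    rw [mul_zero] at this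
    exact this.mono_left nhdsWithin_le_nhds
  have hle : ‖b - b'‖ ≤ 0 := ge_of_tendsto hlim hev
  exact sub_eq_zero.1 (norm_le_zero_iff.1 hle)

/-! ### A map tangent to the identity at `0` is quadratically close to it -/

/-- If `g` is `C²` on an open `s ∋ 0` with `g 0 = 0` and `Dg(0) = 𝟙`, then
`‖g y - y‖ ≤ C ‖y‖²` on a ball around `0` inside `s`. [folklore] -/
theorem exists_norm_sub_self_le_sq {E : Type*} [NormedAddCommGroup E] [NormedSpace ℝ E]
    {g : E → E} {s : Set E} (hs : IsOpen s) (h0 : (0 : E) ∈ s) (hg : ContDiffOn ℝ 2 g s)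
    (hg0 : g 0 = 0) (hDg0 : fderiv ℝ g 0 = ContinuousLinearMap.id ℝ E) :
    ∃ Cq rq : ℝ, 0 ≤ Cq ∧ 0 < rq ∧ ball 0 rq ⊆ s ∧
      ∀ y ∈ ball (0 : E) rq, ‖g y - y‖ ≤ Cq * ‖y‖ ^ 2 := by
  set φ : E → E := fun y => g y - y with hφ
  have hφ2 : ContDiffOn ℝ 2 φ s := hg.sub contDiffOn_id
  have hDφ : ContDiffOn ℝ 1 (fderiv ℝ φ) s := hφ2.fderiv_of_isOpen hs (by norm_cast)
  obtain ⟨K, t, ht, hK⟩ := (hDφ.contDiffAt (hs.mem_nhds h0)).exists_lipschitzOnWith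
  obtain ⟨r₁, hr₁, hr₁t⟩ := Metric.mem_nhds_iff.1 (inter_mem ht (hs.mem_nhds h0))
  -- `Dφ(0) = 0`
  have hgd : DifferentiableAt ℝ g 0 :=
    (hg.differentiableOn (by norm_cast)).differentiableAt (hs.mem_nhds h0)
  have hDφ0 : fderiv ℝ φ 0 = 0 := by
    have h1 : HasFDerivAt φ (fderiv ℝ g 0 - ContinuousLinearMap.id ℝ E) 0 :=
      hgd.hasFDerivAt.sub (hasFDerivAt_id 0)
    rw [h1.fderiv, hDg0, sub_self]
  -- the Lipschitz bound of `Dφ` on the ball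
  have hDφb : ∀ x ∈ ball (0 : E) r₁, ‖fderiv ℝ φ x‖ ≤ K * ‖x‖ := by
    intro x hx
    have := hK.dist_le_mul x (hr₁t hx).1 0 (hr₁t (mem_ball_self hr₁)).1
    rwa [hDφ0, dist_zero_right, dist_zero_right] at this
  have hφd : ∀ x ∈ ball (0 : E) r₁, DifferentiableAt ℝ φ x := fun x hx =>
    (hφ2.differentiableOn (by norm_cast)).differentiableAt (hs.mem_nhds (hr₁t hx).2)
  refine ⟨K, r₁, K.2, hr₁, fun y hy => (hr₁t hy).2, fun y hy => ?_⟩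
  -- mean value on the closed ball of radius `‖y‖`
  have hsub : closedBall (0 : E) ‖y‖ ⊆ ball 0 r₁ := closedBall_subset_ball (mem_ball_zero_iff.1 hy)
  have hmv := (convex_closedBall (0 : E) ‖y‖).norm_image_sub_le_of_norm_fderiv_le
    (f := φ) (C := K * ‖y‖) (fun x hx => hφd x (hsub hx))
    (fun x hx => (hDφb x (hsub hx)).trans (by
      rw [mem_closedBall, dist_zero_right] at hx
      exact mul_le_mul_of_nonneg_left hx K.2))
    (mem_closedBall_self (norm_nonneg y)) (mem_closedBall_zero_iff.2 le_rfl)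
  have hφ0 : φ 0 = 0 := by simp [hφ, hg0]
  rw [hφ0, sub_zero, sub_zero] at hmv
  calc ‖g y - y‖ = ‖φ y‖ := rfl
    _ ≤ K * ‖y‖ * ‖y‖ := hmv
    _ = K * ‖y‖ ^ 2 := by ring

/-! ### The adapted normal form -/

set_option maxHeartbeats 1600000 in
/-- **The `(zᵏ, û)` normal form in a `J`-adapted chart** (Wendl 2020, Thm B.23 first half, with
the coordinates of §B.2.3). Hypotheses as in `jHolomorphic_kthRootNormalForm`. Conclusions: the
block of `jHolomorphic_kthRootNormalForm` (`k ≥ 1`, the smooth chart `Θ`, the `C¹` chart `ξ`, the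
`C¹` map `û = O(|w|^{k+1})`, radii `ρ, ρ₁` with `Θ(u z) = (ξ(z)ᵏ, û(ξ z))` on `B(z₀,ρ)`), and
moreover: a radius `ρ₀ ≥ ρ` on which the representation still holds; the transported structure
`J̃` — smooth on an open `V ∋ 0` containing `Θ.target`, `J̃² = -1` on `V`, standard on normal
vectors at axis points, `J̃(q,0)(0,w) = (0,iw)` for `|q| < r` — for which the chart curve `Θ ∘ u`
is `J̃`-holomorphic on `B(z₀,ρ₀)`; the quantitative Lemma B.29, `|û(w)| ≤ C_u|w|^{k+1}` and
`‖dû(w)‖ ≤ C_u|w|ᵏ` on `B(0,ρ₁)`; and on `B(0,ρ₁) ⊆ ξ.target` the inverse chart maps into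
`B(z₀,ρ₀)` with `‖dξ⁻¹‖ ≤ B_ξ` and `|ξ⁻¹(w) - z₀| ≤ B_ξ |w|`.
[cite: Wendl2020, App. B, Thm B.23, §B.2.3 and Lemma B.29; MicallefWhite1995, Thm 6.1] -/
theorem jHolomorphic_adaptedNormalForm (F : Type) [NormedAddCommGroup F] [NormedSpace ℝ F]
    [FiniteDimensional ℝ F] (hF : Module.finrank ℝ F = 4)
    (J : F → F →L[ℝ] F) (U : Set F) (hU : IsOpen U) (hJ : ContDiffOn ℝ ∞ J U)
    (hJ2 : ∀ x ∈ U, ∀ v : F, J x (J x v) = -v)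
    (u : ℂ → F) (z₀ : ℂ) (R : ℝ) (hR : 0 < R) (hu : ContDiffOn ℝ ∞ u (ball z₀ R))
    (huU : MapsTo u (ball z₀ R) U)
    (hhol : ∀ z ∈ ball z₀ R, ∀ α : ℂ, fderiv ℝ u z (Complex.I * α) = J (u z) (fderiv ℝ u z α))
    (hnc : ∃ᶠ z in 𝓝 z₀, u z ≠ u z₀) :
    ∃ (k : ℕ) (Θ : OpenPartialHomeomorph F (ℂ × ℂ)) (ξ : OpenPartialHomeomorph ℂ ℂ)
      (uhat : ℂ → ℂ) (ρ ρ₁ ρ₀ : ℝ) (Jt : ℂ × ℂ → ℂ × ℂ →L[ℝ] ℂ × ℂ) (V : Set (ℂ × ℂ))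
      (r Cu Bξ : ℝ),
      (0 < k ∧ 0 < ρ ∧ 0 < ρ₁ ∧
      u z₀ ∈ Θ.source ∧ Θ (u z₀) = 0 ∧ ContDiffOn ℝ ∞ Θ Θ.source ∧
        ContDiffOn ℝ ∞ Θ.symm Θ.target ∧
      ball z₀ ρ ⊆ ξ.source ∧ ξ z₀ = 0 ∧ ContDiffOn ℝ 1 ξ ξ.source ∧
        ContDiffOn ℝ 1 ξ.symm ξ.target ∧ ContDiffOn ℝ ∞ ξ (ξ.source \ {z₀}) ∧
      MapsTo ξ (ball z₀ ρ) (ball 0 ρ₁) ∧ ContDiffOn ℝ 1 uhat (ball 0 ρ₁) ∧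
        (uhat =O[𝓝 0] fun w : ℂ => ‖w‖ ^ (k + 1)) ∧
        (∀ z ∈ ball z₀ ρ, u z ∈ Θ.source ∧ Θ (u z) = ((ξ z) ^ k, uhat (ξ z)))) ∧
      -- the bigger radius `ρ₀`
      (ρ ≤ ρ₀ ∧ ball z₀ ρ₀ ⊆ ξ.source ∧ ρ₀ ≤ R ∧
        (∀ z ∈ ball z₀ ρ₀, u z ∈ Θ.source ∧ Θ (u z) = ((ξ z) ^ k, uhat (ξ z))) ∧
        ContDiffOn ℝ ∞ (fun z => Θ (u z)) (ball z₀ ρ₀)) ∧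
      -- the adapted structure `J̃`
      (IsOpen V ∧ (0 : ℂ × ℂ) ∈ V ∧ ContDiffOn ℝ ∞ Jt V ∧ (∀ x ∈ V, ∀ v, Jt x (Jt x v) = -v) ∧
        0 < r ∧
        (∀ q : ℂ, ‖q‖ < r → ((q, (0 : ℂ)) : ℂ × ℂ) ∈ V ∧ ∀ w : ℂ, Jt (q, 0) (0, w) = (0, I * w)) ∧
        Θ.target ⊆ V ∧
        (∀ z ∈ ball z₀ ρ₀, fderiv ℝ (fun z => Θ (u z)) z I =
          Jt (Θ (u z)) (fderiv ℝ (fun z => Θ (u z)) z 1))) ∧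
      -- Lemma B.29 and the inverse `C¹` chart on `B(0,ρ₁)`
      (0 ≤ Cu ∧ (∀ w ∈ ball (0 : ℂ) ρ₁, ‖uhat w‖ ≤ Cu * ‖w‖ ^ (k + 1)) ∧
        (∀ w ∈ ball (0 : ℂ) ρ₁, ‖fderiv ℝ uhat w‖ ≤ Cu * ‖w‖ ^ k) ∧
        ball (0 : ℂ) ρ₁ ⊆ ξ.target ∧ MapsTo ξ.symm (ball (0 : ℂ) ρ₁) (ball z₀ ρ₀) ∧
        0 ≤ Bξ ∧ (∀ w ∈ ball (0 : ℂ) ρ₁, ‖fderiv ℝ ξ.symm w‖ ≤ Bξ) ∧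
        (∀ w ∈ ball (0 : ℂ) ρ₁, ‖ξ.symm w - z₀‖ ≤ Bξ * ‖w‖)) := by
  haveI : CompleteSpace F := FiniteDimensional.complete ℝ F
  set p : F := u z₀ with hp
  have hpU : p ∈ U := huU (mem_ball_self hR)
  have hJ₀2 : ∀ v, J p (J p v) = -v := hJ2 p hpU
  have hhol1 : ∀ z ∈ ball z₀ R, fderiv ℝ u z I = J (u z) (fderiv ℝ u z 1) := fun z hz => by
    simpa using hhol z hz 1
  have hfin : Module.finrank ℝ F = 2 * 2 := by rw [hF]
  -- ### S1: linear coordinates and the leading term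
  obtain ⟨k, Φ, b, C₁, ρa, hk, hb, hρa, hρaR, hΦJ, hval₁, hder₁⟩ :=
    jHolomorphic_leadingTerm hfin hU (hJ.of_le (by norm_cast)) hJ2 hR hu huU hhol1 hnc
  -- ### S2: `A b = (1, 0)` and the real-linear `M = A ∘ Φ`
  obtain ⟨A, hA⟩ := exists_equiv_prod_apply_eq hb
  set Aℝ : EuclideanSpace ℂ (Fin 2) ≃L[ℝ] ℂ × ℂ :=
    (A.toLinearEquiv.restrictScalars ℝ).toContinuousLinearEquiv with hAℝ
  have hAℝ_apply : ∀ x, Aℝ x = A x := fun x => rfl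
  have hAℝ_symm_apply : ∀ y, Aℝ.symm y = A.symm y := fun y => rfl
  set M : F ≃L[ℝ] ℂ × ℂ := Φ.trans Aℝ with hM
  have hM_apply : ∀ v, M v = A (Φ v) := fun v => rfl
  have hM_symm_apply : ∀ y, M.symm y = Φ.symm (A.symm y) := fun y => rfl
  have hMJ : ∀ v, M (J p v) = I • M v := by
    intro v
    rw [hM_apply, hM_apply, hΦJ]
    exact A.map_smul I (Φ v)
  -- ### S3: the affine chart `Θ₁ x = M (x - p)` as a homeomorphism
  set Θ₁h : F ≃ₜ ℂ × ℂ := (Homeomorph.addRight (-p)).trans M.toHomeomorph with hΘ₁h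
  have hΘ₁h_apply : ∀ x, Θ₁h x = M (x + -p) := fun x => rfl
  have hΘ₁h_symm : ∀ y, Θ₁h.symm y = M.symm y + p := fun y => by
    show M.symm y + -(-p) = _
    rw [neg_neg]
  have hΘ₁h_p : Θ₁h p = 0 := by rw [hΘ₁h_apply, add_neg_cancel, map_zero]
  have hΘ₁h_cd : ContDiff ℝ ∞ (fun x : F => (Θ₁h x : ℂ × ℂ)) := by
    have : (fun x : F => (Θ₁h x : ℂ × ℂ)) = fun x => M (x + -p) := funext hΘ₁h_apply
    rw [this]; exact M.contDiff.comp (contDiff_id.add contDiff_const)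
  have hΘ₁h_symm_cd : ContDiff ℝ ∞ (fun y : ℂ × ℂ => (Θ₁h.symm y : F)) := by
    have : (fun y : ℂ × ℂ => (Θ₁h.symm y : F)) = fun y => M.symm y + p := funext hΘ₁h_symm
    rw [this]; exact M.symm.contDiff.add contDiff_const
  have hΘ₁h_d : ∀ x : F, HasFDerivAt (fun x : F => (Θ₁h x : ℂ × ℂ)) (M : F →L[ℝ] ℂ × ℂ) x := by
    intro x
    have : (fun x : F => (Θ₁h x : ℂ × ℂ)) = fun x => M (x + -p) := funext hΘ₁h_apply
    rw [this]
    have h := (M : F →L[ℝ] ℂ × ℂ).hasFDerivAt.comp x ((hasFDerivAt_id x).add_const (-p))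
    rw [ContinuousLinearMap.comp_id] at h
    exact h
  -- ### S4: the transported structure `J̃₁`
  set J₁ : ℂ × ℂ → (ℂ × ℂ →L[ℝ] ℂ × ℂ) := fun y =>
    (M : F →L[ℝ] ℂ × ℂ).comp ((J (M.symm y + p)).comp (M.symm : ℂ × ℂ →L[ℝ] F)) with hJ₁
  have hJ₁_apply : ∀ y w, J₁ y w = M (J (M.symm y + p) (M.symm w)) := fun y w => rfl
  set V₁ : Set (ℂ × ℂ) := {y | M.symm y + p ∈ U} with hV₁
  have hV₁o : IsOpen V₁ := hU.preimage (M.symm.continuous.add continuous_const)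
  have h0V₁ : (0 : ℂ × ℂ) ∈ V₁ := by
    show M.symm 0 + p ∈ U
    rw [map_zero, zero_add]; exact hpU
  have hJ₁s : ContDiffOn ℝ ∞ J₁ V₁ := by
    have h1 : ContDiffOn ℝ ∞ (fun y : ℂ × ℂ => J (M.symm y + p)) V₁ :=
      hJ.comp (M.symm.contDiff.add contDiff_const).contDiffOn fun y hy => hy
    exact contDiffOn_const.clm_comp (h1.clm_comp contDiffOn_const)
  have hJ₁2 : ∀ y ∈ V₁, ∀ w, J₁ y (J₁ y w) = -w := by
    intro y hy w
    rw [hJ₁_apply, hJ₁_apply, ContinuousLinearEquiv.symm_apply_apply, hJ2 _ hy, map_neg,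
      ContinuousLinearEquiv.apply_symm_apply]
  have hJ₁0 : ∀ w, J₁ 0 w = I • w := by
    intro w
    rw [hJ₁_apply, map_zero, zero_add, hMJ, ContinuousLinearEquiv.apply_symm_apply]
  have hJ₁01 : J₁ 0 (0, 1) = (0, I) := by
    rw [hJ₁0]; ext <;> simp
  -- ### S5: the normal-frame chart of `J̃₁`
  obtain ⟨Θc, r, hr, h0c, hΘc0, hΘc, hΘcs, hDΘc0, hcV₁, hΘc_symm, hJt, hJt2, hint, haxis⟩ :=
    NormalFrameChart.exists_normalFrameChart hV₁o h0V₁ hJ₁s hJ₁2 hJ₁01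
  set Jt := NormalFrameChart.pullback J₁ with hJt_def
  -- ### S6: the composite chart into `ℂ²`
  set Θ₀' : OpenPartialHomeomorph F (EuclideanSpace ℂ (Fin 2)) :=
    (Θ₁h.transOpenPartialHomeomorph Θc).transHomeomorph
      (Aℝ.symm : ℂ × ℂ ≃ₜ EuclideanSpace ℂ (Fin 2)) with hΘ₀'
  have hΘ₀'_apply : ∀ x, Θ₀' x = Aℝ.symm (Θc (Θ₁h x)) := fun x => rfl
  have hΘ₀'_source : Θ₀'.source = Θ₁h ⁻¹' Θc.source := rfl
  have hΘ₀'_target : ∀ y, y ∈ Θ₀'.target ↔ Aℝ y ∈ Θc.target := fun y => Iff.rfl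
  have hΘ₀'_symm : ∀ y, Θ₀'.symm y = Θ₁h.symm (Θc.symm (Aℝ y)) := fun y => rfl
  have hpsrc : p ∈ Θ₀'.source := by
    rw [hΘ₀'_source, mem_preimage, hΘ₁h_p]; exact h0c
  have hΘ₀'p : Θ₀' p = 0 := by rw [hΘ₀'_apply, hΘ₁h_p, hΘc0, map_zero]
  have hΘ₀'_coe : (Θ₀' : F → EuclideanSpace ℂ (Fin 2)) = fun x => Aℝ.symm (Θc (Θ₁h x)) :=
    funext hΘ₀'_apply
  have hΘ₀'smooth : ContDiffOn ℝ ∞ Θ₀' Θ₀'.source := by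
    rw [hΘ₀'_source, hΘ₀'_coe]
    have h2 : ContDiffOn ℝ ∞ (fun x => Θc (Θ₁h x)) (Θ₁h ⁻¹' Θc.source) :=
      hΘc.comp hΘ₁h_cd.contDiffOn fun x hx => hx
    exact Aℝ.symm.contDiff.comp_contDiffOn h2
  have hΘ₀'symm_smooth : ContDiffOn ℝ ∞ Θ₀'.symm Θ₀'.target := by
    have h1 : ContDiffOn ℝ ∞ (fun y : EuclideanSpace ℂ (Fin 2) => Θc.symm (Aℝ y)) Θ₀'.target :=
      hΘcs.comp Aℝ.contDiff.contDiffOn fun y hy => (hΘ₀'_target y).1 hy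
    have : (Θ₀'.symm : EuclideanSpace ℂ (Fin 2) → F) = fun y => Θ₁h.symm (Θc.symm (Aℝ y)) :=
      funext hΘ₀'_symm
    rw [this]
    exact hΘ₁h_symm_cd.comp_contDiffOn h1
  -- the differential of `Θ₀'` at `p`
  have hΘc_d0 : HasFDerivAt Θc (ContinuousLinearMap.id ℝ (ℂ × ℂ)) 0 := by
    have hd : DifferentiableAt ℝ Θc 0 :=
      (hΘc.differentiableOn (by simp)).differentiableAt (Θc.open_source.mem_nhds h0c)
    rw [← hDΘc0]; exact hd.hasFDerivAt
  have hΘ₀'_d : HasFDerivAt Θ₀' ((Aℝ.symm : ℂ × ℂ →L[ℝ] EuclideanSpace ℂ (Fin 2)).comp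
      (M : F →L[ℝ] ℂ × ℂ)) p := by
    have h1 : HasFDerivAt (fun x => Θc (Θ₁h x)) ((ContinuousLinearMap.id ℝ (ℂ × ℂ)).comp
        (M : F →L[ℝ] ℂ × ℂ)) p := by
      have h := hΘc_d0
      rw [← hΘ₁h_p] at h
      exact h.comp p (hΘ₁h_d p)
    rw [ContinuousLinearMap.id_comp] at h1
    have h2 := (Aℝ.symm : ℂ × ℂ →L[ℝ] EuclideanSpace ℂ (Fin 2)).hasFDerivAt.comp p h1
    rw [hΘ₀'_coe]
    exact h2
  have hlin : ∀ v, fderiv ℝ Θ₀' (u z₀) (J (u z₀) v) = I • fderiv ℝ Θ₀' (u z₀) v := by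
    intro v
    rw [← hp, hΘ₀'_d.fderiv, ContinuousLinearMap.comp_apply, ContinuousLinearMap.comp_apply,
      ContinuousLinearEquiv.coe_coe, ContinuousLinearEquiv.coe_coe, hMJ, hAℝ_symm_apply,
      hAℝ_symm_apply]
    exact A.symm.map_smul I (M v)
  -- ### S7: the leading term in the composite chart
  obtain ⟨k', b', C₂, ρ₂, hk', hb', hρ₂, hρ₂R, husrc₂, hval₂, hder₂⟩ :=
    jHolomorphic_leadingTerm_chart hU (hJ.of_le (by norm_cast)) hR hu huU hhol1 hnc Θ₀' hpsrc
      hΘ₀'p hΘ₀'smooth (hΘ₀'symm_smooth.of_le (by norm_cast)) hlin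
  -- ### S8: the leading term in the composite chart is again `(k, b)`
  obtain ⟨Cq, rq, hCq, hrq, hrq_sub, hquad⟩ := exists_norm_sub_self_le_sq Θc.open_source h0c
    (hΘc.of_le (by norm_cast)) hΘc0 hDΘc0
  set C₁' : ℝ := max C₁ 0 with hC₁'
  have hC₁'0 : 0 ≤ C₁' := le_max_right _ _
  set nA : ℝ := ‖(Aℝ : EuclideanSpace ℂ (Fin 2) →L[ℝ] ℂ × ℂ)‖ with hnA
  set nAs : ℝ := ‖(Aℝ.symm : ℂ × ℂ →L[ℝ] EuclideanSpace ℂ (Fin 2))‖ with hnAs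
  have hnA_le : ∀ x, ‖Aℝ x‖ ≤ nA * ‖x‖ := fun x =>
    (Aℝ : EuclideanSpace ℂ (Fin 2) →L[ℝ] ℂ × ℂ).le_opNorm x
  have hnAs_le : ∀ y, ‖Aℝ.symm y‖ ≤ nAs * ‖y‖ := fun y =>
    (Aℝ.symm : ℂ × ℂ →L[ℝ] EuclideanSpace ℂ (Fin 2)).le_opNorm y
  have hnA0 : 0 ≤ nA := norm_nonneg _
  have hnAs0 : 0 ≤ nAs := norm_nonneg _
  set K₁ : ℝ := nA * C₁' with hK₁
  have hK₁0 : 0 ≤ K₁ := by positivity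
  set C₃ : ℝ := nAs * (Cq * (1 + K₁) ^ 2 + K₁) with hC₃
  set ρ₃ : ℝ := min ρa (min 1 (rq / (K₁ + 2))) with hρ₃
  have hρ₃pos : 0 < ρ₃ := lt_min hρa (lt_min one_pos (by positivity))
  have hval₃ : ∀ z ∈ ball (0 : ℂ) ρ₃, ‖Θ₀' (u (z₀ + z)) - z ^ k • b‖ ≤ C₃ * ‖z‖ ^ (k + 1) := by
    intro z hz
    have hzn : ‖z‖ < ρ₃ := mem_ball_zero_iff.1 hz
    have hza : z ∈ ball (0 : ℂ) ρa := mem_ball_zero_iff.2 (hzn.trans_le (min_le_left _ _))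
    have hz1 : ‖z‖ ≤ 1 := (hzn.trans_le ((min_le_right _ _).trans (min_le_left _ _))).le
    have hzq : ‖z‖ < rq / (K₁ + 2) := hzn.trans_le ((min_le_right _ _).trans (min_le_right _ _))
    -- the point `y = Θ₁(u(z₀+z))` and its distance to `zᵏ (1,0)`
    set Y : EuclideanSpace ℂ (Fin 2) := Φ (u (z₀ + z) - u z₀) with hY
    set R₁ : EuclideanSpace ℂ (Fin 2) := Y - z ^ k • b with hR₁
    set y : ℂ × ℂ := Θ₁h (u (z₀ + z)) with hy
    clear_value y
    have hy_eq : y = z ^ k • (((1 : ℂ), (0 : ℂ)) : ℂ × ℂ) + Aℝ R₁ := by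
      have h1 : y = Aℝ Y := by
        rw [hy, hΘ₁h_apply, ← sub_eq_add_neg, hp]; rfl
      rw [h1, hR₁, hAℝ_apply, hAℝ_apply, map_sub, map_smul, hA, add_sub_cancel]
    have hR₁b : ‖R₁‖ ≤ C₁' * ‖z‖ ^ (k + 1) :=
      (hval₁ z hza).trans (mul_le_mul_of_nonneg_right (le_max_left _ _) (by positivity))
    have hzk1 : ‖z‖ ^ (k + 1) ≤ ‖z‖ ^ k := pow_le_pow_of_le_one (norm_nonneg _) hz1 (by omega)
    have hzk : ‖z‖ ^ k ≤ ‖z‖ := by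
      calc ‖z‖ ^ k ≤ ‖z‖ ^ 1 := pow_le_pow_of_le_one (norm_nonneg _) hz1 hk
        _ = ‖z‖ := pow_one _
    have hsq : (‖z‖ ^ k) ^ 2 ≤ ‖z‖ ^ (k + 1) := by
      rw [← pow_mul]
      exact pow_le_pow_of_le_one (norm_nonneg _) hz1 (by omega)
    have hdist : ‖y - z ^ k • (((1 : ℂ), (0 : ℂ)) : ℂ × ℂ)‖ ≤ K₁ * ‖z‖ ^ (k + 1) := by
      rw [hy_eq, add_sub_cancel_left]
      calc ‖Aℝ R₁‖ ≤ nA * ‖R₁‖ := hnA_le R₁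
        _ ≤ nA * (C₁' * ‖z‖ ^ (k + 1)) := by gcongr
        _ = K₁ * ‖z‖ ^ (k + 1) := by rw [hK₁]; ring
    have hone : ‖(((1 : ℂ), (0 : ℂ)) : ℂ × ℂ)‖ = 1 := by simp [Prod.norm_def]
    have hyn : ‖y‖ ≤ (1 + K₁) * ‖z‖ ^ k := by
      calc ‖y‖ = ‖z ^ k • (((1 : ℂ), (0 : ℂ)) : ℂ × ℂ) + (y - z ^ k • (((1 : ℂ), (0 : ℂ)) : ℂ × ℂ))‖ := by
            rw [add_sub_cancel]
        _ ≤ ‖z ^ k • (((1 : ℂ), (0 : ℂ)) : ℂ × ℂ)‖ + ‖y - z ^ k • (((1 : ℂ), (0 : ℂ)) : ℂ × ℂ)‖ :=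
            norm_add_le _ _
        _ ≤ ‖z‖ ^ k * 1 + K₁ * ‖z‖ ^ (k + 1) := by
            rw [norm_smul, norm_pow, hone]; exact add_le_add le_rfl hdist
        _ ≤ ‖z‖ ^ k * 1 + K₁ * ‖z‖ ^ k := by gcongr
        _ = (1 + K₁) * ‖z‖ ^ k := by ring
    have hyq : y ∈ ball (0 : ℂ × ℂ) rq := by
      rw [mem_ball_zero_iff]
      have h1 : (1 + K₁) * ‖z‖ ^ k ≤ (1 + K₁) * ‖z‖ := by gcongr
      have h3 : (1 + K₁) * ‖z‖ ≤ (1 + K₁) * (rq / (K₁ + 2)) := by gcongr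
      have h4 : (1 + K₁) * (rq / (K₁ + 2)) < rq := by
        rw [mul_div_assoc', div_lt_iff₀ (by positivity)]; nlinarith
      linarith
    -- the value in the composite chart
    have hval : Θ₀' (u (z₀ + z)) - z ^ k • b =
        Aℝ.symm ((Θc y - y) + (y - z ^ k • (((1 : ℂ), (0 : ℂ)) : ℂ × ℂ))) := by
      have h1 : Θ₀' (u (z₀ + z)) = Aℝ.symm (Θc y) := by rw [hΘ₀'_apply, hy]
      have h2 : z ^ k • b = Aℝ.symm (z ^ k • (((1 : ℂ), (0 : ℂ)) : ℂ × ℂ)) := by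
        rw [hAℝ_symm_apply, map_smul, ← hA, A.symm_apply_apply]
      rw [h1, h2, ← map_sub, sub_add_sub_cancel]
    rw [hval]
    have hin : ‖(Θc y - y) + (y - z ^ k • (((1 : ℂ), (0 : ℂ)) : ℂ × ℂ))‖ ≤
        Cq * ‖y‖ ^ 2 + K₁ * ‖z‖ ^ (k + 1) :=
      (norm_add_le _ _).trans (add_le_add (hquad y hyq) hdist)
    have hy2 : ‖y‖ ^ 2 ≤ (1 + K₁) ^ 2 * ‖z‖ ^ (k + 1) := by
      calc ‖y‖ ^ 2 ≤ ((1 + K₁) * ‖z‖ ^ k) ^ 2 := pow_le_pow_left₀ (norm_nonneg y) hyn 2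
        _ = (1 + K₁) ^ 2 * (‖z‖ ^ k) ^ 2 := by ring
        _ ≤ (1 + K₁) ^ 2 * ‖z‖ ^ (k + 1) := mul_le_mul_of_nonneg_left hsq (by positivity)
    calc ‖Aℝ.symm ((Θc y - y) + (y - z ^ k • (((1 : ℂ), (0 : ℂ)) : ℂ × ℂ)))‖
        ≤ nAs * ‖(Θc y - y) + (y - z ^ k • (((1 : ℂ), (0 : ℂ)) : ℂ × ℂ))‖ := hnAs_le _
      _ ≤ nAs * (Cq * ‖y‖ ^ 2 + K₁ * ‖z‖ ^ (k + 1)) := mul_le_mul_of_nonneg_left hin hnAs0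
      _ ≤ nAs * (Cq * ((1 + K₁) ^ 2 * ‖z‖ ^ (k + 1)) + K₁ * ‖z‖ ^ (k + 1)) :=
          mul_le_mul_of_nonneg_left (add_le_add (mul_le_mul_of_nonneg_left hy2 hCq) le_rfl) hnAs0
      _ = C₃ * ‖z‖ ^ (k + 1) := by rw [hC₃]; ring
  -- uniqueness of leading terms
  have hkb : k = k' ∧ b = b' := by
    refine leadingTerm_unique (f := fun z => Θ₀' (u (z₀ + z))) (lt_min hρ₃pos hρ₂) hb hb'
      (C := C₃) (C' := C₂) (fun z hz => hval₃ z ?_) (fun z hz => hval₂ z ?_)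
    · exact mem_ball_zero_iff.2 ((mem_ball_zero_iff.1 hz).trans_le (min_le_left _ _))
    · exact mem_ball_zero_iff.2 ((mem_ball_zero_iff.1 hz).trans_le (min_le_right _ _))
  obtain ⟨hkk, hbb⟩ := hkb
  subst hkk hbb
  -- ### S9: the `k`-th root normal form in the chart `A ∘ Θ₀' = Θc ∘ Θ₁`
  obtain ⟨Θ, ξ, uhat, ρ', ρ₁, hΘdef, hρ', hρ₁, h1, h2, h3, h4, h5, h6, h7, h8, h9, h10, h11, h12,
    h13⟩ :=
    normalForm_of_chart hρ₂ (hu.mono (ball_subset_ball hρ₂R)) Θ₀' husrc₂ hΘ₀'p hΘ₀'smooth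
      hΘ₀'symm_smooth hk hval₂ hder₂ A hA
  have hΘ_apply : ∀ x, Θ x = Θc (Θ₁h x) := by
    intro x
    rw [hΘdef]
    show A (Aℝ.symm (Θc (Θ₁h x))) = _
    rw [hAℝ_symm_apply, A.apply_symm_apply]
  have hΘ_source : Θ.source = Θ₁h ⁻¹' Θc.source := by rw [hΘdef]; rfl
  have hΘ_tgt : Θ.target ⊆ Θc.target := by
    intro y hy
    have hx := Θ.map_target hy
    rw [← Θ.right_inv hy, hΘ_apply]
    rw [hΘ_source] at hx
    exact Θc.map_source hx
  -- ### S10: radii, the adapted structure, holomorphicity, Lemma B.29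
  set ρ₀ : ℝ := min ρ' ρ₂ with hρ₀
  have hρ₀pos : 0 < ρ₀ := lt_min hρ' hρ₂
  have hρ₀ρ' : ρ₀ ≤ ρ' := min_le_left _ _
  have hρ₀ρ₂ : ρ₀ ≤ ρ₂ := min_le_right _ _
  have hρ₀R : ρ₀ ≤ R := hρ₀ρ₂.trans hρ₂R
  have hrep₀ : ∀ z ∈ ball z₀ ρ₀, u z ∈ Θ.source ∧ Θ (u z) = ((ξ z) ^ k, uhat (ξ z)) :=
    fun z hz => h13 z (ball_subset_ball hρ₀ρ' hz)
  have hξsrc₀ : ball z₀ ρ₀ ⊆ ξ.source := (ball_subset_ball hρ₀ρ').trans h5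
  have hGs : ContDiffOn ℝ ∞ (fun z => Θ (u z)) (ball z₀ ρ₀) :=
    h3.comp (hu.mono (ball_subset_ball hρ₀R)) fun z hz => (hrep₀ z hz).1
  have hV0 : (0 : ℂ × ℂ) ∈ Θc.target := by rw [← hΘc0]; exact Θc.map_source h0c
  -- ### `J̃`-holomorphicity of `Θ ∘ u`
  have hhol₀ : ∀ z ∈ ball z₀ ρ₀, fderiv ℝ (fun z => Θ (u z)) z I =
      Jt (Θ (u z)) (fderiv ℝ (fun z => Θ (u z)) z 1) := by
    intro z hz
    have hzR : z ∈ ball z₀ R := ball_subset_ball hρ₀R hz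
    have hud : DifferentiableAt ℝ u z :=
      (hu.differentiableOn (by simp)).differentiableAt (isOpen_ball.mem_nhds hzR)
    have hu₁d : HasFDerivAt (fun z => Θ₁h (u z)) ((M : F →L[ℝ] ℂ × ℂ).comp (fderiv ℝ u z)) z :=
      (hΘ₁h_d (u z)).comp z hud.hasFDerivAt
    have hu₁hol : fderiv ℝ (fun z => Θ₁h (u z)) z I =
        J₁ (Θ₁h (u z)) (fderiv ℝ (fun z => Θ₁h (u z)) z 1) := by
      rw [hu₁d.fderiv]
      simp only [ContinuousLinearMap.comp_apply, ContinuousLinearEquiv.coe_coe]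
      rw [hhol1 z hzR, hJ₁_apply, hΘ₁h_apply, ContinuousLinearEquiv.symm_apply_apply,
        ContinuousLinearEquiv.symm_apply_apply, neg_add_cancel_right]
    have hus₁ : Θ₁h (u z) ∈ Θc.source := by
      have := (hrep₀ z hz).1
      rw [hΘ_source] at this
      exact this
    have key := NormalFrameChart.jHolomorphic_transfer (Θ := Θc) (J' := J₁) (Jt := Jt)
      Θc.open_source (hΘc.differentiableOn (by simp)) hint hu₁d.differentiableAt hus₁ hu₁hol
    have hfun : (fun z => Θ (u z)) = (Θc ∘ fun z => Θ₁h (u z)) := by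
      funext w; simp only [Function.comp_apply, hΘ_apply]
    rw [hfun, hΘ_apply]
    simpa only [Function.comp_apply] using key
  -- ### Lemma B.29: the inverse chart and `û` on a small ball
  have hξsymm0 : ξ.symm 0 = z₀ := by
    rw [← h6]; exact ξ.left_inv (h5 (mem_ball_self hρ'))
  have h0t : (0 : ℂ) ∈ ξ.target := by rw [← h6]; exact ξ.map_source (h5 (mem_ball_self hρ'))
  have hDξc : ContinuousOn (fderiv ℝ ξ.symm) ξ.target :=
    h8.continuousOn_fderiv_of_isOpen ξ.open_target le_rfl
  obtain ⟨δ₁, hδ₁, hδ₁b⟩ := Metric.continuousAt_iff.1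
    (hDξc.continuousAt (ξ.open_target.mem_nhds h0t)) 1 one_pos
  set Bξ : ℝ := ‖fderiv ℝ ξ.symm 0‖ + 1 with hBξ
  have hBξ0 : 0 ≤ Bξ := by positivity
  have hpre : ξ.target ∩ ξ.symm ⁻¹' ball z₀ ρ₀ ∈ 𝓝 (0 : ℂ) := by
    refine inter_mem (ξ.open_target.mem_nhds h0t) ?_
    have hc : ContinuousAt ξ.symm 0 :=
      ξ.continuousOn_symm.continuousAt (ξ.open_target.mem_nhds h0t)
    refine hc.preimage_mem_nhds ?_
    rw [hξsymm0]; exact isOpen_ball.mem_nhds (mem_ball_self hρ₀pos)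
  obtain ⟨δ₂, hδ₂, hδ₂b⟩ := Metric.mem_nhds_iff.1 hpre
  set ρ₁n : ℝ := min ρ₁ (min δ₁ δ₂) with hρ₁n
  have hρ₁npos : 0 < ρ₁n := lt_min hρ₁ (lt_min hδ₁ hδ₂)
  have hρ₁nρ₁ : ρ₁n ≤ ρ₁ := min_le_left _ _
  have hρ₁nδ₁ : ρ₁n ≤ δ₁ := (min_le_right _ _).trans (min_le_left _ _)
  have hρ₁nδ₂ : ρ₁n ≤ δ₂ := (min_le_right _ _).trans (min_le_right _ _)
  have hballt : ball (0 : ℂ) ρ₁n ⊆ ξ.target := fun w hw =>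
    (hδ₂b (ball_subset_ball hρ₁nδ₂ hw)).1
  have hballρ₀ : MapsTo ξ.symm (ball (0 : ℂ) ρ₁n) (ball z₀ ρ₀) := fun w hw =>
    (hδ₂b (ball_subset_ball hρ₁nδ₂ hw)).2
  have hDξb : ∀ w ∈ ball (0 : ℂ) ρ₁n, ‖fderiv ℝ ξ.symm w‖ ≤ Bξ := by
    intro w hw
    have h1 : dist (fderiv ℝ ξ.symm w) (fderiv ℝ ξ.symm 0) < 1 :=
      hδ₁b (by rw [dist_zero_right]; exact (mem_ball_zero_iff.1 hw).trans_le hρ₁nδ₁)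
    rw [dist_eq_norm] at h1
    calc ‖fderiv ℝ ξ.symm w‖
        = ‖(fderiv ℝ ξ.symm w - fderiv ℝ ξ.symm 0) + fderiv ℝ ξ.symm 0‖ := by rw [sub_add_cancel]
      _ ≤ ‖fderiv ℝ ξ.symm w - fderiv ℝ ξ.symm 0‖ + ‖fderiv ℝ ξ.symm 0‖ := norm_add_le _ _
      _ ≤ Bξ := by rw [hBξ]; linarith
  have hξsd : ∀ w ∈ ball (0 : ℂ) ρ₁n, DifferentiableAt ℝ ξ.symm w := fun w hw =>
    (h8.differentiableOn one_ne_zero).differentiableAt (ξ.open_target.mem_nhds (hballt hw))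
  have hξsl : ∀ w ∈ ball (0 : ℂ) ρ₁n, ‖ξ.symm w - z₀‖ ≤ Bξ * ‖w‖ := by
    intro w hw
    have := (convex_ball (0 : ℂ) ρ₁n).norm_image_sub_le_of_norm_fderiv_le hξsd hDξb
      (mem_ball_self hρ₁npos) hw
    rwa [hξsymm0, sub_zero] at this
  have htρ₂ : ∀ w ∈ ball (0 : ℂ) ρ₁n, ξ.symm w - z₀ ∈ ball (0 : ℂ) ρ₂ := by
    intro w hw
    have := hballρ₀ hw
    rw [mem_ball, dist_eq_norm] at this
    exact mem_ball_zero_iff.2 (this.trans_le hρ₀ρ₂)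
  -- the remainder `R₂` of the leading term in the composite chart
  set C₂' : ℝ := max C₂ 0 with hC₂'
  have hC₂'0 : 0 ≤ C₂' := le_max_right _ _
  set Cu : ℝ := nA * C₂' * Bξ ^ (k + 1) with hCu
  have hCu0 : 0 ≤ Cu := by positivity
  set R₂ : ℂ → EuclideanSpace ℂ (Fin 2) := fun z => Θ₀' (u (z₀ + z)) - z ^ k • b with hR₂
  have hR₂val : ∀ t ∈ ball (0 : ℂ) ρ₂, ‖R₂ t‖ ≤ C₂' * ‖t‖ ^ (k + 1) := fun t ht =>
    (hval₂ t ht).trans (mul_le_mul_of_nonneg_right (le_max_left _ _) (by positivity))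
  have hR₂der : ∀ t ∈ ball (0 : ℂ) ρ₂, ‖fderiv ℝ R₂ t‖ ≤ C₂' * ‖t‖ ^ k := fun t ht =>
    (hder₂ t ht).trans (mul_le_mul_of_nonneg_right (le_max_left _ _) (by positivity))
  have hR₂d : ∀ t ∈ ball (0 : ℂ) ρ₂, DifferentiableAt ℝ R₂ t := by
    intro t ht
    have ht' : z₀ + t ∈ ball z₀ ρ₂ := by simpa [mem_ball, dist_eq_norm] using ht
    have hud : DifferentiableAt ℝ u (z₀ + t) :=
      (hu.differentiableOn (by simp)).differentiableAt
        (isOpen_ball.mem_nhds (ball_subset_ball hρ₂R ht'))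
    have hΘd : DifferentiableAt ℝ Θ₀' (u (z₀ + t)) :=
      (hΘ₀'smooth.differentiableOn (by simp)).differentiableAt
        (Θ₀'.open_source.mem_nhds (husrc₂ ht'))
    have h1 : DifferentiableAt ℝ (fun z => Θ₀' (u (z₀ + z))) t :=
      hΘd.comp t (hud.comp t ((differentiableAt_const _).add differentiableAt_id))
    exact h1.sub ((differentiableAt_id.pow k).smul_const b)
  -- `û` on the small ball, through the inverse chart
  have huhat_eq : ∀ w ∈ ball (0 : ℂ) ρ₁n, uhat w = (Aℝ (R₂ (ξ.symm w - z₀))).2 := by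
    intro w hw
    have hzρ₀ : ξ.symm w ∈ ball z₀ ρ₀ := hballρ₀ hw
    have hξz : ξ (ξ.symm w) = w := ξ.right_inv (hballt hw)
    obtain ⟨-, hrepz⟩ := hrep₀ (ξ.symm w) hzρ₀
    have e1 : Θ (u (ξ.symm w)) = A (Θ₀' (u (ξ.symm w))) := by rw [hΘdef]; rfl
    have e2 : Θ₀' (u (ξ.symm w)) = (ξ.symm w - z₀) ^ k • b + R₂ (ξ.symm w - z₀) := by
      show Θ₀' (u (ξ.symm w)) =
        (ξ.symm w - z₀) ^ k • b + (Θ₀' (u (z₀ + (ξ.symm w - z₀))) - (ξ.symm w - z₀) ^ k • b)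
      rw [add_sub_cancel, add_sub_cancel]
    have e3 : (A (Θ₀' (u (ξ.symm w)))).2 = (Aℝ (R₂ (ξ.symm w - z₀))).2 := by
      rw [e2, map_add, map_smul, hA, hAℝ_apply]
      simp
    calc uhat w = (Θ (u (ξ.symm w))).2 := by rw [hrepz, hξz]
      _ = (Aℝ (R₂ (ξ.symm w - z₀))).2 := by rw [e1]; exact e3
  have hub : ∀ w ∈ ball (0 : ℂ) ρ₁n, ‖uhat w‖ ≤ Cu * ‖w‖ ^ (k + 1) := by
    intro w hw
    rw [huhat_eq w hw]
    calc ‖(Aℝ (R₂ (ξ.symm w - z₀))).2‖ ≤ ‖Aℝ (R₂ (ξ.symm w - z₀))‖ := norm_snd_le _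
      _ ≤ nA * ‖R₂ (ξ.symm w - z₀)‖ := hnA_le _
      _ ≤ nA * (C₂' * ‖ξ.symm w - z₀‖ ^ (k + 1)) := by gcongr; exact hR₂val _ (htρ₂ w hw)
      _ ≤ nA * (C₂' * (Bξ * ‖w‖) ^ (k + 1)) := by gcongr; exact hξsl w hw
      _ = Cu * ‖w‖ ^ (k + 1) := by rw [hCu]; ring
  have hudb : ∀ w ∈ ball (0 : ℂ) ρ₁n, ‖fderiv ℝ uhat w‖ ≤ Cu * ‖w‖ ^ k := by
    intro w hw
    have hev : uhat =ᶠ[𝓝 w] fun w' => (Aℝ (R₂ (ξ.symm w' - z₀))).2 := by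
      filter_upwards [isOpen_ball.mem_nhds hw] with w' hw' using huhat_eq w' hw'
    set Dtot : ℂ →L[ℝ] ℂ × ℂ := (Aℝ : EuclideanSpace ℂ (Fin 2) →L[ℝ] ℂ × ℂ).comp
      ((fderiv ℝ R₂ (ξ.symm w - z₀)).comp (fderiv ℝ ξ.symm w)) with hDtot
    have hcomp : HasFDerivAt (fun w' => (Aℝ (R₂ (ξ.symm w' - z₀))).2)
        ((ContinuousLinearMap.snd ℝ ℂ ℂ).comp Dtot) w := by
      have e1 : HasFDerivAt (fun w' => ξ.symm w' - z₀) (fderiv ℝ ξ.symm w) w :=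
        (hξsd w hw).hasFDerivAt.sub_const z₀
      have e2 : HasFDerivAt R₂ (fderiv ℝ R₂ (ξ.symm w - z₀)) (ξ.symm w - z₀) :=
        (hR₂d _ (htρ₂ w hw)).hasFDerivAt
      have e3 := e2.comp w e1
      have e4 := (Aℝ : EuclideanSpace ℂ (Fin 2) →L[ℝ] ℂ × ℂ).hasFDerivAt.comp w e3
      exact e4.snd
    rw [hev.fderiv_eq, hcomp.fderiv]
    have hD : ‖Dtot‖ ≤ nA * (C₂' * (Bξ * ‖w‖) ^ k * Bξ) := by
      calc ‖Dtot‖ ≤ nA * ‖(fderiv ℝ R₂ (ξ.symm w - z₀)).comp (fderiv ℝ ξ.symm w)‖ :=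
            ContinuousLinearMap.opNorm_comp_le _ _
        _ ≤ nA * (‖fderiv ℝ R₂ (ξ.symm w - z₀)‖ * ‖fderiv ℝ ξ.symm w‖) := by
            gcongr; exact ContinuousLinearMap.opNorm_comp_le _ _
        _ ≤ nA * (C₂' * ‖ξ.symm w - z₀‖ ^ k * Bξ) := by
            gcongr
            · exact hR₂der _ (htρ₂ w hw)
            · exact hDξb w hw
        _ ≤ nA * (C₂' * (Bξ * ‖w‖) ^ k * Bξ) := by gcongr; exact hξsl w hw
    calc ‖(ContinuousLinearMap.snd ℝ ℂ ℂ).comp Dtot‖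
        ≤ ‖ContinuousLinearMap.snd ℝ ℂ ℂ‖ * ‖Dtot‖ := ContinuousLinearMap.opNorm_comp_le _ _
      _ ≤ 1 * (nA * (C₂' * (Bξ * ‖w‖) ^ k * Bξ)) := by
          gcongr; exact ContinuousLinearMap.norm_snd_le ℝ ℂ ℂ
      _ = Cu * ‖w‖ ^ k := by rw [hCu]; ring
  -- ### the final radius `ρ` with `ξ(B(z₀,ρ)) ⊆ B(0,ρ₁)`
  have hξc : ContinuousAt ξ z₀ :=
    h7.continuousOn.continuousAt (ξ.open_source.mem_nhds (h5 (mem_ball_self hρ')))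
  obtain ⟨δ₃, hδ₃, hδ₃b⟩ := Metric.continuousAt_iff.1 hξc ρ₁n hρ₁npos
  set ρn : ℝ := min ρ₀ δ₃ with hρn
  have hρnpos : 0 < ρn := lt_min hρ₀pos hδ₃
  have hρnρ₀ : ρn ≤ ρ₀ := min_le_left _ _
  have hmaps : MapsTo ξ (ball z₀ ρn) (ball 0 ρ₁n) := by
    intro z hz
    have e1 : dist (ξ z) (ξ z₀) < ρ₁n := hδ₃b ((mem_ball.1 hz).trans_le (min_le_right _ _))
    rw [h6] at e1
    exact mem_ball.2 e1
  refine ⟨k, Θ, ξ, uhat, ρn, ρ₁n, ρ₀, Jt, Θc.target, r, Cu, Bξ,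
    ⟨hk, hρnpos, hρ₁npos, h1, h2, h3, h4, (ball_subset_ball hρnρ₀).trans hξsrc₀, h6, h7, h8, h9,
      hmaps, h11.mono (ball_subset_ball hρ₁nρ₁), h12,
      fun z hz => hrep₀ z (ball_subset_ball hρnρ₀ hz)⟩,
    ⟨hρnρ₀, hξsrc₀, hρ₀R, hrep₀, hGs⟩,
    ⟨Θc.open_target, hV0, hJt, hJt2, hr, haxis, hΘ_tgt, hhol₀⟩,
    ⟨hCu0, hub, hudb, hballt, hballρ₀, hBξ0, hDξb, hξsl⟩⟩

end Literature.Geometry.Symplectic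

end
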